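import Literature.NumberTheory.EllipticCurves.CyclotomicLayerTatePairing
import Literature.NumberTheory.EllipticCurves.GreenbergSelmerCofreeTorsionGaloisModule
import HarnessLib

/-!
# A transport `Θ : A_ρ ≃ E[p^∞]^r` on torsion: `Θ⁻¹` on each copy of `E[p^k]` (`thetaSingle`), `Θ_k : A_ρ[p^k] ≃ E[p^k]^r`,
# and the Θ-TRANSPORTED KUMMER CLASSES of layer points `E(ℚ_{n,v})^r → H¹(U_n, A_ρ[p^k]|)` (`thetaLayerKummer`)

Topic `NumberTheory/EllipticCurves`; namespaces = path + the sub-namespaces of the objects served: §1 in `GreenbergSelmer`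
(operations on the cofree module `Cofree ρ F = A_ρ = F^d/𝒪^d` of a framed representation, file `GreenbergSelmerNewform`), §2 in
`CyclotomicLayer` (the layer objects of `CyclotomicLayerTatePairing.lean`, whose layer groups `layerGroup`, local torsion modules
`torsionLocalRep` and Kummer maps `layerKummer` are REUSED verbatim). Definition typer `bsd-wall-defn-rho` (cell `bsd-wall`) for
the pin PIN-SPEC-S2-g16 of crux RSL_g (stmt-BirchSwinnertonDyer-22608) in the currency LANDED by the route lead
(`GreenbergSelmer.reduceH1CofreePkTorsion` p670789, `GreenbergSelmer.cofreeTorsionGaloisModule` p671214: the coefficient module of the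
`ρ`-side layer Tate pairing is the `p^k`-torsion `A_ρ[p^k]` of the cofree module): this file supplies the SECOND ARGUMENT of that
pairing — where the transport `Θ` enters. DEFINITIONS WITH BODIES and PROVED lemmas only: no named fact, no instance, no notation,
no `sorry`; nothing here is specific to any summit and BSD is not advanced by this file.

## Setting

`ρ : Γ_ℚ →ₜ* GL_d(𝒪)` a framed Galois representation (`FramedGaloisRep ℚ 𝒪 d`), `A_ρ = Cofree ρ F` its cofree module (`Γ_ℚ` acts
through `ρ`), `W/ℚ` a Weierstrass curve with geometric `p`-power torsion `E[p^∞] = W.geomPrimaryTorsion p` and `E[p^k] =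
geomTorsion W (p^k)` (inside `E(ℚ̄)`), and a TRANSPORT: an additive isomorphism `Θ : A_ρ ≃+ E[p^∞]^r` (the binder of the crux:
"`Θ v hv : Cofree ρ F ≃+ (Fin n → W.geomPrimaryTorsion 2)`") which is equivariant for the decomposition group at a place `v`
acting through `resGalOfEmb (closureEmb ℚ_v)` (hypothesis `hΘ`, verbatim the crux binder). No Galois-equivariance of `Θ` beyond
`hΘ` is assumed, and `Θ` is never constructed here.

## Contents

* §1 (namespace `GreenbergSelmer`, any coefficient pair `𝒪 → F`)
  - `thetaSingle ρ p k W Θ i : E[p^k] →+ A_ρ[p^k]`, `P ↦ Θ⁻¹(P·δ_i)` (`P` in coordinate `i`; lands in the `p^k`-torsion because `Θ⁻¹` is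
    additive), `coe_thetaSingle`, **`thetaSingle_smul`** (equivariant for `Γ_{ℚ_v}` under `hΘ`), `sum_thetaSingle`
    (`Σ_i Θ⁻¹(P_i·δ_i) = Θ⁻¹(P)`);
  - `thetaTorsionCoord Θ k i : A_ρ[p^k] →+ E[p^k]`, `a ↦ (Θ a)_i` and **`thetaTorsionEquiv Θ k : A_ρ[p^k] ≃+ (Fin r → E[p^k])`** —
    the restriction `Θ_k` of `Θ` to the `p^k`-torsion (memo §1 (c): "kernel of `p^k` on both sides, `Θ` additive ⇒ automatic"), with
    inverse `P ↦ Σ_i thetaSingle i (P i)`; consequence **`finite_cofreeTorsionBy_of_theta`**: `A_ρ[p^k]` is finite whenever such a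
    `Θ` exists and `W` is elliptic (`E[p^k]` finite, `finite_geomTorsion_of_neZero`) — the `[Finite M]` that local Tate duality
    (`DiscreteGaloisModule.localTatePairing`, `tateDual`) asks of `M = A_ρ[p^k]`, discharged in the crux's own setting (memo §4 D2(d)).
* §2 (namespace `CyclotomicLayer`, `𝒪 = padicCoeffIntegers S`, `F = padicCoeffField S`, the lead's `cofreeTorsionGaloisModule S ρ N`)
  - `cofreeTorsionLocalRep S ρ N v` — `A_ρ[N](ℚ̄)|_{Γ_v}` as a `TopRep` (the `ρ`-twin of `torsionLocalRep W N v`);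
  - `thetaSingle_subgroupRep` (equivariance for the layer subgroup `U_n ≤ Γ_v`), **`thetaSingleH1 … i n : H¹(U_n, E[p^k]|) →+
    H¹(U_n, A_ρ[p^k]|)`** (`mapH1AddHom` along `thetaSingle i`), its cocycle formula;
  - **`thetaLayerKummer … κ v hΘ n : (Fin r → E(ℚ_{n,v})) →+ H¹(U_n, A_ρ[p^k]|)`**, `Q ↦ Σ_i (thetaSingle i)_* κ_{U_n}(Q_i)` — the
    Θ-transported Kummer classes of an `r`-tuple of layer points (`CyclotomicLayer.layerKummer` componentwise); `thetaLayerKummer_apply`.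
  Pairing `thetaLayerKummer … Q` with the localisation of `reduceH1CofreePkTorsion S ρ k (κ.layerSubgroup n) x` under the layer cup
  product of `A_ρ[p^k]` (route lead, `CyclotomicLayer.layerPairingH1Of`) is the `ρ`-coefficient layer Tate pairing `⟨x, Q⟩_{n,p^k}` of the
  memo, read through `Θ`; by `sum_thetaSingle` / `thetaTorsionEquiv` the class `thetaLayerKummer … Q` is the Kummer-type class of the
  tuple `Q` for the coefficient module `A_ρ[p^k] ≅_Θ E[p^k]^r`.

NOT here: the pairing `e : A_ρ[p^k] × A_ρ[p^k] → μ_{p^k}` (self-duality of `ρ`, `det ρ = ε`), the cup product (lead's files), the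
`ℤ_p`-adic limit, any reciprocity law, any construction of `Θ`, any named fact.

## References

* [Greenberg1989] R. Greenberg, *Iwasawa theory for p-adic representations*, §1 p. 98 (`A_p = V_p/T_p`, "as a group just `(ℚ_p/ℤ_p)^d`").
* [EmertonPollackWeston2006] §3.1 (`A_f = K/𝒪 ⊗ T_f`).
* [Kobayashi2003] S. Kobayashi, Invent. Math. 152 (2003), §2 (p. 4) and (8.23) (p. 18) (Kummer maps of layer points, the layer pairing).
* [SilvermanAEC2009] VIII §2 (Kummer pairing), III §7 (`E[m]`, `E[p^∞]`). [SerreGaloisCohomology1997] I §2.2 (functoriality of `H¹`).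
* [Kato2004Asterisque] §14.9 (p. 239) (local Tate duality with `O_λ`-coefficients, `T*(1) ⊗ ℚ/ℤ`).
-/

noncomputable section

open scoped Classical

namespace Literature.NumberTheory.EllipticCurves

-- `_root_.WeierstrassCurve`: inside `namespace Literature.NumberTheory.EllipticCurves` a bare `open WeierstrassCurve` would open the
-- directory-shadowed sub-namespace only (CONVENTIONS §2).
open CategoryTheory Field NumberField IsDedekindDomain _root_.WeierstrassCurve
  Literature.NumberTheory.GaloisRepresentations
  Literature.NumberTheory.EllipticCurves.Kobayashi2003
  Literature.NumberTheory.GaloisCohomology ZpExtension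

namespace GreenbergSelmer

/-! ## §1 `Θ⁻¹` on each copy of `E[p^k]`, and `Θ_k : A_ρ[p^k] ≃ E[p^k]^r` -/

section Theta

variable {𝒪 : Type*} [CommRing 𝒪] [TopologicalSpace 𝒪] {d : ℕ} (ρ : FramedGaloisRep ℚ 𝒪 d) (p : ℕ) (k : ℕ)
  (W : WeierstrassCurve ℚ) {F : Type*} [Field F] [Algebra 𝒪 F] {r : ℕ}
  (Θ : Cofree ρ F ≃+ (Fin r → W.geomPrimaryTorsion p))

omit [TopologicalSpace 𝒪] in
/-- `E[p^k] ⊆ E[p^∞] = ⋃_m E[p^m]` (the level `p^k` written as the `ℕ`-cast index, as in `CyclotomicLayer.layerPairingPk`).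
[cite: Greenberg1989, §1 p. 98] -/
theorem geomTorsion_natCast_pow_le_geomPrimaryTorsion :
    geomTorsion W ((p ^ k : ℕ) : ℤ) ≤ W.geomPrimaryTorsion p :=
  fun _ hP ↦ ⟨k, AddSubgroup.torsionBy.nsmul_iff.mp hP⟩

/-- The additive map `E[p^k] → A_ρ`, `P ↦ Θ⁻¹(P·δ_i)`: `P` placed in coordinate `i` of `E[p^∞]^r` (`AddMonoidHom.single`) and pulled
back along the transport `Θ`. [cite: Greenberg1989, §1 p. 98] -/
def thetaSingleHom (i : Fin r) : geomTorsion W ((p ^ k : ℕ) : ℤ) →+ Cofree ρ F :=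
  Θ.symm.toAddMonoidHom.comp
    ((AddMonoidHom.single (fun _ : Fin r ↦ ↥(W.geomPrimaryTorsion p)) i).comp
      (AddSubgroup.inclusion (geomTorsion_natCast_pow_le_geomPrimaryTorsion p k W)))

/-- Unfolding `thetaSingleHom`. [cite: Greenberg1989, §1 p. 98] -/
theorem thetaSingleHom_apply (i : Fin r) (P : geomTorsion W ((p ^ k : ℕ) : ℤ)) :
    thetaSingleHom ρ p k W Θ i P =
      Θ.symm (Pi.single i (AddSubgroup.inclusion (geomTorsion_natCast_pow_le_geomPrimaryTorsion p k W) P)) :=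
  rfl

/-- **`thetaSingle Θ i : E[p^k] →+ A_ρ[p^k]`, `P ↦ Θ⁻¹(P·δ_i)`** — `Θ⁻¹` on the `i`-th copy of `E[p^k]`, with values in the
`p^k`-torsion of `A_ρ` (`Θ⁻¹` is additive and `p^k P = 0`). Summed over `i` these give `Θ⁻¹` on `E[p^k]^r` (`sum_thetaSingle`), i.e.
the inverse of `Θ_k : A_ρ[p^k] ≃ E[p^k]^r` (`thetaTorsionEquiv`). [cite: Greenberg1989, §1 p. 98] -/
def thetaSingle (i : Fin r) :
    geomTorsion W ((p ^ k : ℕ) : ℤ) →+ AddSubgroup.torsionBy (Cofree ρ F) ((p ^ k : ℕ) : ℤ) :=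
  (thetaSingleHom ρ p k W Θ i).codRestrict _ fun P ↦ by
    rw [AddSubgroup.torsionBy, Submodule.mem_toAddSubgroup, Submodule.mem_torsionBy_iff]
    change ((p ^ k : ℕ) : ℤ) • thetaSingleHom ρ p k W Θ i P = 0
    rw [← map_zsmul, show ((p ^ k : ℕ) : ℤ) • P = 0 from
      Subtype.ext (CyclotomicLayer.zsmul_coe_geomTorsion_pow W k P), map_zero]

/-- Unfolding `thetaSingle` in `A_ρ`. [cite: Greenberg1989, §1 p. 98] -/
theorem coe_thetaSingle (i : Fin r) (P : geomTorsion W ((p ^ k : ℕ) : ℤ)) :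
    ((thetaSingle ρ p k W Θ i P : AddSubgroup.torsionBy (Cofree ρ F) ((p ^ k : ℕ) : ℤ)) : Cofree ρ F) =
      Θ.symm (Pi.single i (AddSubgroup.inclusion (geomTorsion_natCast_pow_le_geomPrimaryTorsion p k W) P)) :=
  rfl

/-- **`Σ_i Θ⁻¹(P_i·δ_i) = Θ⁻¹(P)`**: on an `r`-tuple `P ∈ E[p^k]^r` the maps `thetaSingle i` sum to `Θ⁻¹` (`Θ⁻¹` additive,
`Σ_i P_i·δ_i = P`). [cite: Greenberg1989, §1 p. 98] -/
theorem sum_thetaSingle (P : Fin r → geomTorsion W ((p ^ k : ℕ) : ℤ)) :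
    ∑ i, ((thetaSingle ρ p k W Θ i (P i) : AddSubgroup.torsionBy (Cofree ρ F) ((p ^ k : ℕ) : ℤ)) : Cofree ρ F) =
      Θ.symm (fun i ↦ AddSubgroup.inclusion (geomTorsion_natCast_pow_le_geomPrimaryTorsion p k W) (P i)) := by
  simp only [coe_thetaSingle, ← map_sum]
  exact congrArg Θ.symm (Finset.univ_sum_single _)

variable (v : HeightOneSpectrum (𝓞 ℚ))
  (hΘ : ∀ (δ : absoluteGaloisGroup (v.adicCompletion ℚ)) (m : Cofree ρ F) (i : Fin r),
    Θ (resGalOfEmb (closureEmb (K := ℚ) (v.adicCompletion ℚ)) δ • m) i =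
      resGalOfEmb (closureEmb (K := ℚ) (v.adicCompletion ℚ)) δ • Θ m i)

include hΘ in
/-- **`thetaSingle` is equivariant for the decomposition group at `v`**: `Θ⁻¹((δP)·δ_i) = δ · Θ⁻¹(P·δ_i)` for `δ ∈ Γ_{ℚ_v}` acting
through `resGalOfEmb (closureEmb ℚ_v)` (`= absGaloisRestrict ℚ ℚ_v`), from the equivariance `hΘ` of `Θ` coordinate by coordinate — the
verbatim shape of the crux binder on `Θ`. [cite: Greenberg1989, §1 p. 98] -/
theorem thetaSingle_smul (i : Fin r) (δ : absoluteGaloisGroup (v.adicCompletion ℚ))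
    (P : geomTorsion W ((p ^ k : ℕ) : ℤ)) :
    thetaSingle ρ p k W Θ i (resGalOfEmb (closureEmb (K := ℚ) (v.adicCompletion ℚ)) δ • P) =
      resGalOfEmb (closureEmb (K := ℚ) (v.adicCompletion ℚ)) δ • thetaSingle ρ p k W Θ i P := by
  apply Subtype.ext
  rw [coe_thetaSingle, AddSubgroup.torsionBy.coe_smul, coe_thetaSingle]
  apply Θ.injective
  rw [AddEquiv.apply_symm_apply]
  funext j
  rw [hΘ δ _ j, AddEquiv.apply_symm_apply]
  by_cases hj : j = i
  · subst hj
    rw [Pi.single_eq_same, Pi.single_eq_same]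
    rfl
  · rw [Pi.single_eq_of_ne hj, Pi.single_eq_of_ne hj, smul_zero]

/-- A `p^k`-torsion element of `A_ρ` has its `Θ`-coordinates in `E[p^k]` (`Θ` additive). [cite: Greenberg1989, §1 p. 98] -/
theorem coe_theta_apply_mem_geomTorsion (a : AddSubgroup.torsionBy (Cofree ρ F) ((p ^ k : ℕ) : ℤ)) (i : Fin r) :
    ((Θ (a : Cofree ρ F) i : W.geomPrimaryTorsion p) : geomPoints W) ∈ geomTorsion W ((p ^ k : ℕ) : ℤ) := by
  rw [mem_geomTorsion_iff]
  have ha : ((p ^ k : ℕ) : ℤ) • (a : Cofree ρ F) = 0 := (Submodule.mem_torsionBy_iff (R := ℤ) _ _).mp a.2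
  have h := congrArg (fun f : Fin r → ↥(W.geomPrimaryTorsion p) ↦ ((f i : W.geomPrimaryTorsion p) : geomPoints W))
    (show Θ (((p ^ k : ℕ) : ℤ) • (a : Cofree ρ F)) = ((p ^ k : ℕ) : ℤ) • Θ (a : Cofree ρ F) from map_zsmul Θ _ _)
  simp only [ha, map_zero, Pi.zero_apply, Pi.smul_apply, ZeroMemClass.coe_zero, AddSubgroupClass.coe_zsmul] at h
  exact h.symm

/-- **The `i`-th `Θ`-coordinate on the `p^k`-torsion: `A_ρ[p^k] →+ E[p^k]`, `a ↦ (Θ a)_i`.** [cite: Greenberg1989, §1 p. 98] -/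
def thetaTorsionCoord (i : Fin r) :
    AddSubgroup.torsionBy (Cofree ρ F) ((p ^ k : ℕ) : ℤ) →+ geomTorsion W ((p ^ k : ℕ) : ℤ) where
  toFun a := ⟨((Θ (a : Cofree ρ F) i : W.geomPrimaryTorsion p) : geomPoints W), coe_theta_apply_mem_geomTorsion ρ p k W Θ a i⟩
  map_zero' := Subtype.ext (by
    change ((Θ ((0 : AddSubgroup.torsionBy (Cofree ρ F) ((p ^ k : ℕ) : ℤ)) : Cofree ρ F) i : W.geomPrimaryTorsion p) :
      geomPoints W) = 0
    rw [ZeroMemClass.coe_zero, map_zero]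
    rfl)
  map_add' a b := Subtype.ext (by
    change ((Θ ((a + b : AddSubgroup.torsionBy (Cofree ρ F) ((p ^ k : ℕ) : ℤ)) : Cofree ρ F) i : W.geomPrimaryTorsion p) :
      geomPoints W) = ((Θ (a : Cofree ρ F) i : W.geomPrimaryTorsion p) : geomPoints W) +
        ((Θ (b : Cofree ρ F) i : W.geomPrimaryTorsion p) : geomPoints W)
    rw [AddMemClass.coe_add, map_add]
    rfl)

/-- Unfolding `thetaTorsionCoord` on underlying points of `E(ℚ̄)`. [cite: Greenberg1989, §1 p. 98] -/
@[simp] theorem coe_thetaTorsionCoord (i : Fin r) (a : AddSubgroup.torsionBy (Cofree ρ F) ((p ^ k : ℕ) : ℤ)) :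
    ((thetaTorsionCoord ρ p k W Θ i a : geomTorsion W ((p ^ k : ℕ) : ℤ)) : geomPoints W) =
      ((Θ (a : Cofree ρ F) i : W.geomPrimaryTorsion p) : geomPoints W) :=
  rfl

/-- **`Θ_k : A_ρ[p^k] ≃+ E[p^k]^r`** — the transport restricted to the `p^k`-torsion (memo PIN-SPEC-S2 §1 (c): the kernels of `p^k`
on both sides correspond under the additive isomorphism `Θ`): `a ↦ ((Θ a)_i)_i` with inverse `P ↦ Σ_i Θ⁻¹(P_i·δ_i)`
(`sum_thetaSingle`). [cite: Greenberg1989, §1 p. 98] -/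
def thetaTorsionEquiv :
    AddSubgroup.torsionBy (Cofree ρ F) ((p ^ k : ℕ) : ℤ) ≃+ (Fin r → geomTorsion W ((p ^ k : ℕ) : ℤ)) :=
  AddEquiv.ofBijective (AddMonoidHom.pi fun i ↦ thetaTorsionCoord ρ p k W Θ i) (by
    constructor
    · intro a b h
      apply Subtype.ext
      apply Θ.injective
      funext i
      apply Subtype.ext
      exact congrArg (fun f : Fin r → geomTorsion W ((p ^ k : ℕ) : ℤ) ↦ ((f i : geomTorsion W _) : geomPoints W)) h
    · intro P
      refine ⟨⟨∑ i, ((thetaSingle ρ p k W Θ i (P i) : AddSubgroup.torsionBy (Cofree ρ F) ((p ^ k : ℕ) : ℤ)) : Cofree ρ F),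
        AddSubgroup.sum_mem _ fun i _ ↦ (thetaSingle ρ p k W Θ i (P i)).2⟩, ?_⟩
      funext i
      apply Subtype.ext
      rw [AddMonoidHom.pi_apply, coe_thetaTorsionCoord]
      change ((Θ (∑ j, ((thetaSingle ρ p k W Θ j (P j) : AddSubgroup.torsionBy (Cofree ρ F) _) : Cofree ρ F)) i :
        W.geomPrimaryTorsion p) : geomPoints W) = _
      rw [sum_thetaSingle, AddEquiv.apply_symm_apply]
      rfl)

/-- Unfolding `Θ_k`: its `i`-th coordinate is `(Θ a)_i`. [cite: Greenberg1989, §1 p. 98] -/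
@[simp] theorem coe_thetaTorsionEquiv_apply (a : AddSubgroup.torsionBy (Cofree ρ F) ((p ^ k : ℕ) : ℤ)) (i : Fin r) :
    ((thetaTorsionEquiv ρ p k W Θ a i : geomTorsion W ((p ^ k : ℕ) : ℤ)) : geomPoints W) =
      ((Θ (a : Cofree ρ F) i : W.geomPrimaryTorsion p) : geomPoints W) :=
  rfl

include Θ in
/-- **`A_ρ[p^k]` is finite** whenever a transport `Θ : A_ρ ≃+ E[p^∞]^r` exists and `W` is elliptic (`E[p^k]` finite for `p^k ≠ 0`,
`finite_geomTorsion_of_neZero`, and `Θ_k : A_ρ[p^k] ≃ E[p^k]^r`) — the `[Finite M]` of local Tate duality for `M = A_ρ[p^k]` (memo §4 D2(d)),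
in the setting of the crux. [cite: SilvermanAEC2009, Cor. III.6.4] -/
theorem finite_cofreeTorsionBy_of_theta [W.IsElliptic] [NeZero (p ^ k)] :
    Finite (AddSubgroup.torsionBy (Cofree ρ F) ((p ^ k : ℕ) : ℤ)) := by
  haveI : Finite (geomTorsion W ((p ^ k : ℕ) : ℤ)) := finite_geomTorsion_of_neZero W (p ^ k)
  exact Finite.of_equiv _ (thetaTorsionEquiv ρ p k W Θ).toEquiv.symm

end Theta

end GreenbergSelmer

namespace CyclotomicLayer

/-! ## §2 The Θ-transported Kummer classes of layer points in `H¹(U_n, A_ρ[p^k]|)` -/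

section Kummer

open GreenbergSelmer

variable {p : ℕ} [Fact p.Prime] (S : Set (PadicAlgCl p)) {d : ℕ} (ρ : FramedGaloisRep ℚ (padicCoeffIntegers S) d)
  (N : ℤ) (k : ℕ) (W : WeierstrassCurve ℚ) {r : ℕ}
  (Θ : Cofree ρ (padicCoeffField S) ≃+ (Fin r → W.geomPrimaryTorsion p)) (κ : ZpExtension ℚ p)
  (v : HeightOneSpectrum (𝓞 ℚ))
  (hΘ : ∀ (δ : absoluteGaloisGroup (v.adicCompletion ℚ)) (m : Cofree ρ (padicCoeffField S)) (i : Fin r),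
    Θ (resGalOfEmb (closureEmb (K := ℚ) (v.adicCompletion ℚ)) δ • m) i =
      resGalOfEmb (closureEmb (K := ℚ) (v.adicCompletion ℚ)) δ • Θ m i)

/-- `A_ρ[N](ℚ̄)|_{Γ_v}`: the finite discrete Galois module `A_ρ[N]` (`GreenbergSelmer.cofreeTorsionGaloisModule S ρ N`) restricted to the
decomposition group at `v` (along `absGaloisRestrict ℚ ℚ_v = resGalOfEmb (closureEmb ℚ_v)`), as a `TopRep` — the `ρ`-twin of
`CyclotomicLayer.torsionLocalRep W N v`, the coefficient object of `H¹(U_n, A_ρ[N]|)`. [cite: Greenberg1989, §1 p. 98] -/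
abbrev cofreeTorsionLocalRep : TopRep ℤ (absoluteGaloisGroup (v.adicCompletion ℚ)) :=
  DiscreteGaloisModule.toTopRep (GaloisRep.restrictField (v.adicCompletion ℚ) (cofreeTorsionGaloisModule S ρ N))

include hΘ in
/-- Equivariance of `thetaSingle i` for the layer subgroup `U_n ≤ Γ_v` acting on `E[p^k]|` and `A_ρ[p^k]|` (the hypothesis shape of
`mapH1AddHom`; from `thetaSingle_smul`). [cite: Greenberg1989, §1 p. 98] -/
theorem thetaSingle_subgroupRep (i : Fin r) (n : ℕ) (u : layerGroup κ v n) (P : geomTorsion W ((p ^ k : ℕ) : ℤ)) :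
    thetaSingle ρ p k W Θ i ((subgroupRep (torsionLocalRep W (p ^ k) v) (layerGroup κ v n)).ρ u P) =
      (subgroupRep (cofreeTorsionLocalRep S ρ ((p ^ k : ℕ) : ℤ) v) (layerGroup κ v n)).ρ u (thetaSingle ρ p k W Θ i P) :=
  thetaSingle_smul ρ p k W Θ v hΘ i (u : absoluteGaloisGroup (v.adicCompletion ℚ)) P

/-- **`(thetaSingle i)_* : H¹(U_n, E[p^k]|) →+ H¹(U_n, A_ρ[p^k]|)`** — functoriality of `H¹_cont(U_n, ·)` along the `U_n`-equivariant map
`Θ⁻¹(·δ_i) : E[p^k] → A_ρ[p^k]` (`mapH1AddHom`; both coefficient modules discrete). [cite: SerreGaloisCohomology1997, I §2.2] -/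
def thetaSingleH1 (i : Fin r) (n : ℕ) :
    continuousCohomology 1 (subgroupRep (torsionLocalRep W (p ^ k) v) (layerGroup κ v n)) →+
      continuousCohomology 1 (subgroupRep (cofreeTorsionLocalRep S ρ ((p ^ k : ℕ) : ℤ) v) (layerGroup κ v n)) :=
  mapH1AddHom (subgroupRep (torsionLocalRep W (p ^ k) v) (layerGroup κ v n))
    (subgroupRep (cofreeTorsionLocalRep S ρ ((p ^ k : ℕ) : ℤ) v) (layerGroup κ v n)) (thetaSingle ρ p k W Θ i)
    continuous_of_discreteTopology (thetaSingle_subgroupRep S ρ k W Θ κ v hΘ i n)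

/-- `(thetaSingle i)_*` on explicit cocycles: `[φ] ↦ [Θ⁻¹(φ·δ_i)]`. [cite: SerreGaloisCohomology1997, I §2.2] -/
theorem thetaSingleH1_oneCocycleClass (i : Fin r) (n : ℕ)
    (φ : contOneCocycles (subgroupRep (torsionLocalRep W (p ^ k) v) (layerGroup κ v n))) :
    thetaSingleH1 S ρ k W Θ κ v hΘ i n (oneCocycleClass _ φ) =
      oneCocycleClass _ (contOneCocycles.pushAddHom (thetaSingle ρ p k W Θ i) continuous_of_discreteTopology
        (thetaSingle_subgroupRep S ρ k W Θ κ v hΘ i n) φ) :=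
  mapH1AddHom_oneCocycleClass _ _ _ φ

variable [W.IsElliptic]

/-- **The Θ-transported Kummer classes of layer points**: `E(ℚ_{n,v})^r →+ H¹(U_n, A_ρ[p^k]|)`,
`Q = (Q_i)_i ↦ Σ_i (thetaSingle i)_* κ_{U_n}(Q_i)`, where `κ_{U_n} = CyclotomicLayer.layerKummer W (p^k) κ v n : E(ℚ_{n,v}) →+ H¹(U_n, E[p^k]|)`
is the Kummer map of the layer (`Q_i ↦ [τ ↦ τR_i − R_i]`, `p^k R_i = Q_i`). Under `Θ_k : A_ρ[p^k] ≃ E[p^k]^r` this is the Kummer-type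
class of the tuple `Q` with coefficients `A_ρ[p^k]` — the second argument of the `ρ`-coefficient layer Tate pairing of the memo
(the first being the localisation of `GreenbergSelmer.reduceH1CofreePkTorsion S ρ k (κ.layerSubgroup n) x`).
[cite: Kobayashi2003, §2 (p. 4) and (8.23) (p. 18)] [cite: SilvermanAEC2009, VIII §2] -/
def thetaLayerKummer (n : ℕ) :
    (Fin r → localLayerPointsOfEmb κ (closureEmb (K := ℚ) (v.adicCompletion ℚ)) W n) →+
      continuousCohomology 1 (subgroupRep (cofreeTorsionLocalRep S ρ ((p ^ k : ℕ) : ℤ) v) (layerGroup κ v n)) :=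
  ∑ i : Fin r, (thetaSingleH1 S ρ k W Θ κ v hΘ i n).comp ((layerKummer W (p ^ k) κ v n).comp
    (Pi.evalAddMonoidHom (fun _ : Fin r ↦ ↥(localLayerPointsOfEmb κ (closureEmb (K := ℚ) (v.adicCompletion ℚ)) W n)) i))

/-- **Unfolding the Θ-Kummer map**: `thetaLayerKummer Q = Σ_i (thetaSingle i)_* κ_{U_n}(Q_i)`. [cite: Kobayashi2003, (8.23) (p. 18)] -/
theorem thetaLayerKummer_apply (n : ℕ) (Q : Fin r → localLayerPointsOfEmb κ (closureEmb (K := ℚ) (v.adicCompletion ℚ)) W n) :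
    thetaLayerKummer S ρ k W Θ κ v hΘ n Q =
      ∑ i : Fin r, thetaSingleH1 S ρ k W Θ κ v hΘ i n (layerKummer W (p ^ k) κ v n (Q i)) := by
  rw [thetaLayerKummer, AddMonoidHom.finsetSum_apply]
  rfl

/-- The Θ-Kummer map on a tuple supported in one coordinate: `thetaLayerKummer (Q·δ_i) = (thetaSingle i)_* κ_{U_n}(Q)`.
[cite: Kobayashi2003, (8.23) (p. 18)] -/
theorem thetaLayerKummer_single (n : ℕ) (i : Fin r)
    (Q : localLayerPointsOfEmb κ (closureEmb (K := ℚ) (v.adicCompletion ℚ)) W n) :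
    thetaLayerKummer S ρ k W Θ κ v hΘ n (Pi.single i Q) =
      thetaSingleH1 S ρ k W Θ κ v hΘ i n (layerKummer W (p ^ k) κ v n Q) := by
  rw [thetaLayerKummer_apply, Finset.sum_eq_single i]
  · rw [Pi.single_eq_same]
  · intro j _ hj
    rw [Pi.single_eq_of_ne hj, map_zero, map_zero]
  · exact fun h ↦ (h (Finset.mem_univ i)).elim

end Kummer

end CyclotomicLayer

end Literature.NumberTheory.EllipticCurves

end
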